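import Summits.BirchSwinnertonDyer.BirchSwinnertonDyer.Theorems.QuadraticBranchSignedControlPlusEtaLowerInclusionTamagawaRoad
import Summits.BirchSwinnertonDyer.BirchSwinnertonDyer.Theorems.QuadraticBranchSignedControlPlusEtaLowerInclusionFunctionalEquationSqueezeAlgebra
import Literature.NumberTheory.EllipticCurves.Kim2008.AlgebraicFunctionalEquationSigned
import HarnessLib

/-!
# Route `QuadraticBranchSignedControl` (rung K8, cell `bsd-potss`), crux `PlusEtaLowerInclusion`
# (item stmt-BirchSwinnertonDyer-19601): the FUNCTIONAL-EQUATION SQUEEZE — (E⁺_η) (indeed (C1⁺_η))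
# at a tower-onto pair from B. D. Kim's algebraic functional equation at `η`, ONE factor `p` on the
# algebraic side, and an `L_p⁺(V,η,X)` whose cofactor splits into two non-self-dual primes

WHAT. g3's valuation squeeze (p499967 … p507131) reduces the crux at a tower-onto pair of rank
`r = rank V^{(p*)}(ℚ)` to ONE inequality `v_p(coeff_r ξ_η) ≥ v_an := v_p(coeff_r L_p⁺(V,η,T))`:
Kato's side gives `ξ_η ∣ Lη`, the signed rank bound gives `T^r ∣ ξ_η`, and `Lη = ξ_η · c` with `c` a unit
iff the two `r`-th coefficients have the same valuation. On the census residue row `69150v1` (`p = 5`,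
`r = 1`, two Tamagawa-`5` primes, `v_an = 2`) every level-zero instrument gives only ONE factor of `p`
(`a = 1`: Tamagawa road p515151), the second being a height index (`b = 1`, g10, the η-analogue of
Castella's formula — not in print). THIS FILE proves a road that needs ONLY ONE FACTOR OF `p`:

  Kobayashi Thm. 1.2 / 1.3 / 2.2(η) / 4.1(η), Kitajima–Otsuki Thm. 1.3(η) (NAMED facts, as in p505261)
  + B. D. KIM 2008 Thm. 3.11 at `η` (NAMED fact `Kim2008.thm311_etaSignedSelmerDual_charIdeal_map_invol`:
    `Char X⁺(V/K_∞)^η` is FIXED by the Iwasawa involution `ι : T ↦ (1+T)⁻¹ − 1`, `η² = 1`)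
  + `ρ_{V,p^∞}` onto + the `V`-certificate
  + ANALYTIC SHAPE `Lη = u · T^r · (T − c₁)(T − c₂)` with `u ∈ Λˣ`, `c₁, c₂ ∈ pℤ_p ∖ {0}` (a finite
    `p`-adic computation per pair: `μ(Lη) = 0`, `λ(Lη) = r + 2`, the distinguished cofactor SPLITS with
    simple roots mod `p²` — Hensel)
  + ALGEBRAIC input `p ∣ #(X_η/TX_η)_tors` (ONE factor of `p`; per pair from the Tamagawa road)
  ⟹ (C1⁺_η)(V,p) and (E⁺_η)(V,p).

WHY (the `Λ`-algebra brick, companion file `…FunctionalEquationSqueezeAlgebra`). Write `ξ_η = T^r ξ'`. Then `ξ' ∣ u (T−c₁)(T−c₂)` and BOTH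
`T − c_i` are PRIME in `Λ = ℤ_p⟦T⟧` (distinguished of degree one; tree `span_coe_isPrime_of_dvd`), so
`ξ' ∈ {1, T−c₁, T−c₂, (T−c₁)(T−c₂)}·Λˣ` (`dvd_unit_mul_prime_mul_prime_cases`). The unit option is
excluded by the ONE factor of `p` (`p ∣ coeff_r ξ_η = ξ'(0)`). The two lone-prime options are excluded by
the FUNCTIONAL EQUATION: `(ξ_η)` is `ι`-stable (Kim), `(T)` is `ι`-stable (`ι T = −T(1+T)⁻¹`), hence
`(ξ')` is `ι`-stable — but a degree-one distinguished polynomial `T − c` with `c ∈ pℤ_p ∖ {0}` is NEVER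
`ι`-self-associate when `p ≠ 2` (`not_associated_invol_X_sub_C`: `ι(T − c) = ((1+T)⁻¹ − 1) − c`;
comparing constant and linear coefficients of `ι(T−c)·w = T − c` gives `w(0) = 1` and `c · w₁ = −2`,
i.e. `c ∣ 2`, impossible for `c ∈ pℤ_p`, `p` odd). So `ξ' ~ (T−c₁)(T−c₂)` and `(ξ_η) = (Lη)`. In words:
the two extra zeros of `L_p⁺(V,η,X)` are `ℚ_p`-RATIONAL, NON-CLASSICAL points `T = c₁, c₂` of the
cyclotomic line, swapped by `s ↦ −s`; Kato forces `Char X_η ∣ Lη`, the one factor of `p` forces `Char X_η`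
to see at least one of them, and the functional equation forces it to see both.

§1 is the road in the frame of p505261 (`…_of_torsionCoinvariantsDvd`, copied with the final squeeze
replaced); §2 fills the torsion slot by the Tamagawa road (p515151 §1, `hPT`) with `a = 1`:
`1 + r ≤ ∑_{ℓ∈T} ord_p c_ℓ(W)`. The residue row `69150v1` is recorded in the companion file
`…PlusEtaR1FunctionalEquationRows01` (kit j304159: `L_5⁺(V,η,X) ~ T·(T−c₁)(T−c₂)`, `c₁ ≡ 10`,
`c₂ ≡ 15 (mod 25)`).

HONEST FRAMING (cell `bsd-potss`, run/shared/lean/pub/bsd-potss/; FULL-BSD rank ≤ 1 programme, HUMAN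
RULING D-0036/D-0074): TOOL THEOREMS ONLY, CONDITIONAL on the named Literature facts in hypothesis
position (Kobayashi 2003 Thm. 1.2/1.3/2.2η/4.1η, Kitajima–Otsuki 2018 Thm. 1.3η, B. D. Kim 2008 Thm. 3.11η,
Milne I.4.10 in §3), on the tower-onto hypothesis, the `V`-certificate, the per-pair analytic shape and
the per-pair algebraic factor of `p` (supplied here for NO pair). The crux 19601 (class-wide Eisenstein
inclusion at `η`) is OPEN and NOT closed; nothing is booked; `BSD(W, p)` is claimed for no pair. No
definition, no named fact minted, no `sorry`, axioms standard. Seat `bsd-potss-k8eta-c1` (prover), g11;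
`--supports stmt-BirchSwinnertonDyer-19601`.

References: [KimBD2008MRL] Thm. 3.11 with Thm. 3.10 (p. 93), §1 (p. 83); [Kobayashi2003] Thm. 2.2 (p. 5),
§4 + Thm. 4.1 (p. 8); [KitajimaOtsuki2018] Thm. 1.3; [Washington1997] §7.1 (Weierstrass preparation,
distinguished polynomials), §13.2 (the involution); [MazurTateTeitelbaum1986Invent] Ch. I §17;
[MilneADT2006] I Thm. 4.10; [GreenbergLNM1716] §3–§4.
-/

set_option autoImplicit false
set_option linter.dupNamespace false

noncomputable section

open scoped Classical AddSubgroup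

open CongruenceSubgroup Field NumberField IsDedekindDomain WeierstrassCurve
open Literature.NumberTheory.EllipticCurves
open Literature.NumberTheory.EllipticCurves.ModularForms
open Literature.NumberTheory.GaloisRepresentations
open Literature.NumberTheory.GaloisCohomology
open Literature.NumberTheory.EllipticCurves.IwasawaDual
open Literature.NumberTheory.EllipticCurves.IwasawaAlgebra
open Summit.BirchSwinnertonDyer.Rank1Residual.Additive

namespace Summit.BirchSwinnertonDyer.BirchSwinnertonDyer.Theorems

/-! ## §1 The road: (C1⁺_η) and (E⁺_η) at a tower-onto pair from the functional equation, the
analytic shape and ONE factor of `p` in `#(X_η/TX_η)_tors` -/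

section Pair

variable {V : WeierstrassCurve ℚ} [V.IsElliptic] [V.IsGloballyMinimal] {p : ℕ} [hp : Fact p.Prime]

/-- **(E⁺_η) AT A TOWER-ONTO PAIR — the functional-equation squeeze.** GRANTED Kobayashi's Thm. 1.2 /
1.3 / 2.2(η) / 4.1(η), Kitajima–Otsuki's Thm. 1.3 at `η` AND B. D. Kim's Thm. 3.11 at `η` (NAMED facts,
hypothesis position), on a good `a_p = 0` pair with `p ≥ 5`, `ρ_{V,p^m}` onto, the `V`-certificate, the
ANALYTIC SHAPE `hshape` (`L_p⁺(V,η,T) = u·T^r·(T − c₁)(T − c₂)`, `c_i ∈ pℤ_p ∖ {0}`,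
`r = rank V^{(p*)}(ℚ)`, for every branch function — they differ by units; a finite `p`-adic computation
per pair) and the ALGEBRAIC input `htors` (`p ∣ #(X_η/TX_η)_tors` for every `η`-datum — ONE factor of
`p`): (E⁺_η)(V, p). Chain: Thm. 2.2η (f.g. torsion, a characteristic series `g`), Thm. 4.1η with tower
onto (`g ∣ Lη`), §2 of p499967 (`T^r ∣ g`), p502879 + p505261 (`coeff_r g = unit · #coker φ`,
`#(X_η/TX_η)_tors ∣ #coker φ`, so `p ∣ coeff_r g`), Kim 3.11η (`ι`-stability of `(g)`), §1.
CONDITIONAL on the displayed inputs; closes nothing class-wide; certifies no row by itself.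
[cite: KimBD2008MRL, Thm. 3.11 (p. 93)] [cite: Kobayashi2003, Thm. 2.2 (p. 5), Thm. 4.1 and §4 (p. 8)]
[cite: KitajimaOtsuki2018, Thm. 1.3] [cite: CoatesSchneiderSujatha2003, §3 (30)–(31)] -/
theorem quadraticBranchPlusEtaLowerInclusionAt_of_namedFacts_of_invol_of_feShape_of_torsionDvd
    (h12 : Kobayashi2003.thm12_signedSelmerDual_finite_torsion)
    (h13 : Kobayashi2003.thm41_signedCharIdeal_divisibility)
    (h22 : Kobayashi2003.thm22_etaSignedSelmerDual_finite_torsion)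
    (h41 : Kobayashi2003.thm41_plusEtaCharIdeal_dvd)
    (hKO : KitajimaOtsuki2018.mainThm13_etaSignedSelmerDual_noFiniteSubmodule)
    (hFE : Kim2008.thm311_etaSignedSelmerDual_charIdeal_map_invol)
    (hp5 : 5 ≤ p) (hgood : V.HasGoodReductionAtPrime p) (hap : V.frobeniusTrace p = 0)
    (hsurj : ∀ m : ℕ, V.HasSurjectiveModNGaloisRep (p ^ m : ℕ))
    (hcertV : ∀ {N : ℕ} [NeZero N] (f : CuspForm (Gamma0 N) 2), IsNewformOf V f →
      ∃ L : IwasawaAlgebra p, Kobayashi2003.IsSignedPAdicLFunction f p 1 L ∧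
        IsUnit (PowerSeries.coeff V.mordellWeilRank L))
    (hshape : ∀ {N : ℕ} [NeZero N] {f : CuspForm (Gamma0 N) 2}, IsNewformOf V f →
      ∀ (ϖ : ℚ), (if Even (p / 2) then (ϖ : ℝ) * V.realPeriodRat = plusPeriod f
          else (ϖ : ℝ) * V.imaginaryPeriodRat = minusPeriod f) →
      ∀ (Lη : IwasawaAlgebra p), IsQuadraticBranchPlusLFunction f p ϖ Lη →
        ∃ (u : IwasawaAlgebra p) (c₁ c₂ : ℤ_[p]), IsUnit u ∧ (p : ℤ_[p]) ∣ c₁ ∧ (p : ℤ_[p]) ∣ c₂ ∧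
          c₁ ≠ 0 ∧ c₂ ≠ 0 ∧
          Lη = u * PowerSeries.X ^ (V.quadraticTwist ((-1) ^ (p / 2) * p)).mordellWeilRank *
            ((PowerSeries.X - PowerSeries.C c₁) * (PowerSeries.X - PowerSeries.C c₂)))
    (htors : ∀ (K₀ : Type) [Field K₀] [NumberField K₀] [IsCyclotomicExtension {p} ℚ K₀]
      [(galRange (K := ℚ) K₀).Normal] (ηq : absoluteGaloisGroup ℚ →* ℤˣ),
      (∀ σ ∈ galRange (K := ℚ) K₀, ηq σ = 1) → ηq ≠ 1 →
      ∀ (κ : ZpExtension ℚ p) (γ : absoluteGaloisGroup ℚ),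
        κ.IsCyclotomic → κ.IsTopGenerator γ → γ ∈ galRange (K := ℚ) K₀ → IsCyclotomicVariable p γ →
      ∀ {N : ℕ} [NeZero N] {f : CuspForm (Gamma0 N) 2}, IsNewformOf V f →
      ∀ (ϖ : ℚ), (if Even (p / 2) then (ϖ : ℝ) * V.realPeriodRat = plusPeriod f
          else (ϖ : ℝ) * V.imaginaryPeriodRat = minusPeriod f) →
      ∀ (Lη : IwasawaAlgebra p), IsQuadraticBranchPlusLFunction f p ϖ Lη →
        PowerSeries.coeff (V.quadraticTwist ((-1) ^ (p / 2) * p)).mordellWeilRank Lη ≠ 0 →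
      ∀ (D : EtaSignedSelmerDualData V κ K₀ ℚ_[p] ηq γ 1),
        p ∣ Nat.card (AddCommGroup.torsion (IwasawaAlgebra.coinvariants p D.X))) :
    QuadraticBranchPlusEtaLowerInclusionAt V p := by
  intro K₀ _ _ _ _ ηq hηK hη1 N _ f hp2 hgood' hap' hf ϖ hϖ Lη hL κ γ hκ hγ hγK hγc D
  obtain ⟨hfin, htor⟩ :=
    EtaSignedSelmerDualData.finite_isTorsion_of_thm22 h22 hηK hp2 hgood' hap' hκ hγ hγK D
  haveI : Module.Finite (IwasawaAlgebra p) D.X := hfin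
  obtain ⟨g, hg⟩ := (charIdeal_isPrincipal_holds p D.X).principal
  have hg' : D.charIdeal = Ideal.span {g} := hg
  -- Kato side: `g ∣ Lη`
  obtain ⟨-, hup⟩ := EtaSignedSelmerDualData.thm41_plus_of_facts h22 h41 hηK hη1 hp2 hgood' hap' hf
    ϖ hϖ Lη hL hκ hγ hγK hγc D
  have hgL : g ∣ Lη := by
    have h := hup hsurj
    rw [hg', Ideal.span_singleton_le_span_singleton] at h
    exact h
  -- the analytic shape and `coeff_r Lη ≠ 0`
  obtain ⟨u, c₁, c₂, hu, hc₁, hc₂, hc₁0, hc₂0, hLs⟩ := hshape hf ϖ hϖ Lη hL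
  have hne : PowerSeries.coeff (V.quadraticTwist ((-1) ^ (p / 2) * p)).mordellWeilRank Lη ≠ 0 :=
    coeff_ne_zero_of_feShape p hu hc₁0 hc₂0 hLs
  -- rank bound, leading coefficient, torsion divisibility: `p ∣ coeff_r g`
  have hXg := X_pow_twistRank_dvd_etaCharGenerator_of_namedFacts_of_certV h12 h13 h22 hp5 hgood hap
    hsurj (fun f hf => hcertV f hf) hf K₀ ηq hηK hη1 κ γ hκ hγ hγK hγc D hg'
  obtain ⟨w, hw⟩ := coeff_twistRank_etaCharGenerator_eq_unit_mul_card_coker_bockstein h12 h13 h22 h41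
    hKO hp5 hgood hap hsurj (fun f hf => hcertV f hf) hf ϖ hϖ Lη hL hne K₀ ηq hηK hη1 κ γ hκ hγ hγK hγc
    D hg'
  obtain ⟨-, hdvd⟩ := ker_bockstein_eq_bot_and_natCard_torsion_coinvariants_dvd h12 h13 h22 h41 hKO
    hp5 hgood hap hsurj (fun f hf => hcertV f hf) hf ϖ hϖ Lη hL hne K₀ ηq hηK hη1 κ γ hκ hγ hγK hγc D
  have hcoef : (p : ℤ_[p]) ∣
      PowerSeries.coeff (V.quadraticTwist ((-1) ^ (p / 2) * p)).mordellWeilRank g := by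
    rw [hw]
    obtain ⟨c, hc⟩ := (htors K₀ ηq hηK hη1 κ γ hκ hγ hγK hγc hf ϖ hϖ Lη hL hne D).trans hdvd
    refine Dvd.dvd.mul_left ?_ _
    rw [hc, Nat.cast_mul]
    exact dvd_mul_right _ _
  -- the algebraic functional equation at `η` (B. D. Kim Thm. 3.11): `(g)` is `ι`-stable
  have hι : Ideal.map (invol p) (Ideal.span {g}) = Ideal.span {g} := by
    have h := hFE p K₀ ηq hηK V (by omega) hgood' hap' κ γ hκ hγ hγK 1 D.toLiterature
    rw [EtaSignedSelmerDualData.charIdeal_toLiterature, hg'] at h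
    exact h
  -- squeeze
  have heq : Ideal.span {g} = Ideal.span {Lη} :=
    span_singleton_eq_of_invol_of_feShape p hp2 hu hc₁ hc₂ hc₁0 hc₂0 hLs hXg hgL hι hcoef
  rw [← heq, ← hg']

/-- **(E⁺_η) ∧ (C1⁺_η) at a tower-onto pair from the functional-equation squeeze** (the previous
theorem and `quadraticBranchPlusEtaMainConjectureAt_of_facts_of_surjective_of_etaLowerInclusion`).
CONDITIONAL; closes nothing class-wide. [cite: KimBD2008MRL, Thm. 3.11 (p. 93)]
[cite: Kobayashi2003, Thm. 2.2 (p. 5), §4 Even main conjecture and Thm. 4.1 (p. 8)] -/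
theorem quadraticBranchPlusEta_pair_of_namedFacts_of_invol_of_feShape_of_torsionDvd
    (h12 : Kobayashi2003.thm12_signedSelmerDual_finite_torsion)
    (h13 : Kobayashi2003.thm41_signedCharIdeal_divisibility)
    (h22 : Kobayashi2003.thm22_etaSignedSelmerDual_finite_torsion)
    (h41 : Kobayashi2003.thm41_plusEtaCharIdeal_dvd)
    (hKO : KitajimaOtsuki2018.mainThm13_etaSignedSelmerDual_noFiniteSubmodule)
    (hFE : Kim2008.thm311_etaSignedSelmerDual_charIdeal_map_invol)
    (hp5 : 5 ≤ p) (hgood : V.HasGoodReductionAtPrime p) (hap : V.frobeniusTrace p = 0)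
    (hsurj : ∀ m : ℕ, V.HasSurjectiveModNGaloisRep (p ^ m : ℕ))
    (hcertV : ∀ {N : ℕ} [NeZero N] (f : CuspForm (Gamma0 N) 2), IsNewformOf V f →
      ∃ L : IwasawaAlgebra p, Kobayashi2003.IsSignedPAdicLFunction f p 1 L ∧
        IsUnit (PowerSeries.coeff V.mordellWeilRank L))
    (hshape : ∀ {N : ℕ} [NeZero N] {f : CuspForm (Gamma0 N) 2}, IsNewformOf V f →
      ∀ (ϖ : ℚ), (if Even (p / 2) then (ϖ : ℝ) * V.realPeriodRat = plusPeriod f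
          else (ϖ : ℝ) * V.imaginaryPeriodRat = minusPeriod f) →
      ∀ (Lη : IwasawaAlgebra p), IsQuadraticBranchPlusLFunction f p ϖ Lη →
        ∃ (u : IwasawaAlgebra p) (c₁ c₂ : ℤ_[p]), IsUnit u ∧ (p : ℤ_[p]) ∣ c₁ ∧ (p : ℤ_[p]) ∣ c₂ ∧
          c₁ ≠ 0 ∧ c₂ ≠ 0 ∧
          Lη = u * PowerSeries.X ^ (V.quadraticTwist ((-1) ^ (p / 2) * p)).mordellWeilRank *
            ((PowerSeries.X - PowerSeries.C c₁) * (PowerSeries.X - PowerSeries.C c₂)))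
    (htors : ∀ (K₀ : Type) [Field K₀] [NumberField K₀] [IsCyclotomicExtension {p} ℚ K₀]
      [(galRange (K := ℚ) K₀).Normal] (ηq : absoluteGaloisGroup ℚ →* ℤˣ),
      (∀ σ ∈ galRange (K := ℚ) K₀, ηq σ = 1) → ηq ≠ 1 →
      ∀ (κ : ZpExtension ℚ p) (γ : absoluteGaloisGroup ℚ),
        κ.IsCyclotomic → κ.IsTopGenerator γ → γ ∈ galRange (K := ℚ) K₀ → IsCyclotomicVariable p γ →
      ∀ {N : ℕ} [NeZero N] {f : CuspForm (Gamma0 N) 2}, IsNewformOf V f →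
      ∀ (ϖ : ℚ), (if Even (p / 2) then (ϖ : ℝ) * V.realPeriodRat = plusPeriod f
          else (ϖ : ℝ) * V.imaginaryPeriodRat = minusPeriod f) →
      ∀ (Lη : IwasawaAlgebra p), IsQuadraticBranchPlusLFunction f p ϖ Lη →
        PowerSeries.coeff (V.quadraticTwist ((-1) ^ (p / 2) * p)).mordellWeilRank Lη ≠ 0 →
      ∀ (D : EtaSignedSelmerDualData V κ K₀ ℚ_[p] ηq γ 1),
        p ∣ Nat.card (AddCommGroup.torsion (IwasawaAlgebra.coinvariants p D.X))) :
    QuadraticBranchPlusEtaLowerInclusionAt V p ∧ QuadraticBranchPlusEtaMainConjectureAt V p := by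
  have hE : QuadraticBranchPlusEtaLowerInclusionAt V p :=
    quadraticBranchPlusEtaLowerInclusionAt_of_namedFacts_of_invol_of_feShape_of_torsionDvd h12 h13 h22
      h41 hKO hFE hp5 hgood hap hsurj (fun f hf => hcertV f hf) (fun hf => hshape hf) htors
  exact ⟨hE, quadraticBranchPlusEtaMainConjectureAt_of_facts_of_surjective_of_etaLowerInclusion h22 h41
    hsurj hE⟩

end Pair

/-! ## §2 The torsion slot filled by the Tamagawa road (`a = 1`): ONE Tamagawa factor of `p` beyond
the rank suffices -/

section Tamagawa

variable {V : WeierstrassCurve ℚ} [V.IsElliptic] [V.IsGloballyMinimal] {p : ℕ} [hp : Fact p.Prime]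

/-- **THE FUNCTIONAL-EQUATION SQUEEZE ON A TAMAGAWA ROW: (E⁺_η) ∧ (C1⁺_η) at a tower-onto pair of any
rank.** GRANTED Kobayashi's Thm. 1.2 / 1.3 / 2.2(η) / 4.1(η), Kitajima–Otsuki's Thm. 1.3 at `η`,
B. D. Kim's Thm. 3.11 at `η` and Poitou–Tate duality (NAMED facts), on a good `a_p = 0` pair with `p ≥ 5`,
`ρ_{V,p^m}` onto, the `V`-certificate, the `p*`-partner `W` (`C • W^{(p*)} = V`) with a finite `T ∌ (p)`
containing every `ℓ ≠ p` with `p ∣ c_ℓ(W)` and `ord_p c_ℓ(W) ≤ 1` on `T`, the ARITHMETIC input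
`1 + r ≤ ∑_{ℓ ∈ T} ord_p c_ℓ(W)` (`r = rank V^{(p*)}(ℚ)`; ONE Tamagawa factor of `p` beyond the rank —
p515151 §1 then gives `p ∣ #(X_η/TX_η)_tors`) and the ANALYTIC SHAPE `L_p⁺(V,η,T) = u·T^r·(T−c₁)(T−c₂)`
(`c_i ∈ pℤ_p ∖ {0}`): (E⁺_η)(V, p) ∧ (C1⁺_η)(V, p). On crux 19601's residue row `69150v1` (`c₂ = 5`,
`c₃ = 10`, `r = 1`): `1 + 1 ≤ 2` — NO height index needed. CONDITIONAL; closes nothing class-wide.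
[cite: KimBD2008MRL, Thm. 3.11 (p. 93)] [cite: Kobayashi2003, Thm. 2.2 (p. 5), §4 and Thm. 4.1 (p. 8), Thm. 9.3 (pp. 26–27)]
[cite: KitajimaOtsuki2018, Thm. 1.3] [cite: MilneADT2006, Ch. I, Thm. 4.10] -/
theorem quadraticBranchPlusEta_pair_of_namedFacts_of_invol_of_poitouTate_of_tamagawa_of_feShape
    (h12 : Kobayashi2003.thm12_signedSelmerDual_finite_torsion)
    (h13 : Kobayashi2003.thm41_signedCharIdeal_divisibility)
    (h22 : Kobayashi2003.thm22_etaSignedSelmerDual_finite_torsion)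
    (h41 : Kobayashi2003.thm41_plusEtaCharIdeal_dvd)
    (hKO : KitajimaOtsuki2018.mainThm13_etaSignedSelmerDual_noFiniteSubmodule)
    (hFE : Kim2008.thm311_etaSignedSelmerDual_charIdeal_map_invol)
    (hPT : poitouTate_selmerStructure_duality_real ℚ)
    (hp5 : 5 ≤ p) (hgood : V.HasGoodReductionAtPrime p) (hap : V.frobeniusTrace p = 0)
    (hsurj : ∀ m : ℕ, V.HasSurjectiveModNGaloisRep (p ^ m : ℕ))
    (hcertV : ∀ {N : ℕ} [NeZero N] (f : CuspForm (Gamma0 N) 2), IsNewformOf V f →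
      ∃ L : IwasawaAlgebra p, Kobayashi2003.IsSignedPAdicLFunction f p 1 L ∧
        IsUnit (PowerSeries.coeff V.mordellWeilRank L))
    (W : WeierstrassCurve ℚ) [W.IsElliptic] [W.IsGloballyMinimal] (C : VariableChange ℚ)
    (hCV : C • W.quadraticTwist ((-1) ^ (p / 2) * p) = V)
    (T : Finset (HeightOneSpectrum (𝓞 ℚ)))
    (hpT : (Rat.HeightOneSpectrum.primesEquiv (R := 𝓞 ℚ)).symm ⟨p, hp.out⟩ ∉ T)
    (hT : ∀ v : HeightOneSpectrum (𝓞 ℚ), v ≠ (Rat.HeightOneSpectrum.primesEquiv (R := 𝓞 ℚ)).symm ⟨p, hp.out⟩ →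
      p ∣ (W.baseChange (v.adicCompletion ℚ)).localTamagawaNumber (v.adicCompletionIntegers ℚ) → v ∈ T)
    (hT1 : ∀ w ∈ T, padicValNat p ((W.baseChange (w.adicCompletion ℚ)).localTamagawaNumber
      (w.adicCompletionIntegers ℚ)) ≤ 1)
    (ha : 1 + (V.quadraticTwist ((-1) ^ (p / 2) * p)).mordellWeilRank ≤
      ∑ w ∈ T, padicValNat p ((W.baseChange (w.adicCompletion ℚ)).localTamagawaNumber
        (w.adicCompletionIntegers ℚ)))
    (hshape : ∀ {N : ℕ} [NeZero N] {f : CuspForm (Gamma0 N) 2}, IsNewformOf V f →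
      ∀ (ϖ : ℚ), (if Even (p / 2) then (ϖ : ℝ) * V.realPeriodRat = plusPeriod f
          else (ϖ : ℝ) * V.imaginaryPeriodRat = minusPeriod f) →
      ∀ (Lη : IwasawaAlgebra p), IsQuadraticBranchPlusLFunction f p ϖ Lη →
        ∃ (u : IwasawaAlgebra p) (c₁ c₂ : ℤ_[p]), IsUnit u ∧ (p : ℤ_[p]) ∣ c₁ ∧ (p : ℤ_[p]) ∣ c₂ ∧
          c₁ ≠ 0 ∧ c₂ ≠ 0 ∧
          Lη = u * PowerSeries.X ^ (V.quadraticTwist ((-1) ^ (p / 2) * p)).mordellWeilRank *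
            ((PowerSeries.X - PowerSeries.C c₁) * (PowerSeries.X - PowerSeries.C c₂))) :
    QuadraticBranchPlusEtaLowerInclusionAt V p ∧ QuadraticBranchPlusEtaMainConjectureAt V p := by
  -- the torsion slot, for every `η`-datum, from the Tamagawa road with `v = 1`
  refine quadraticBranchPlusEta_pair_of_namedFacts_of_invol_of_feShape_of_torsionDvd h12 h13 h22 h41 hKO
    hFE hp5 hgood hap hsurj (fun f hf => hcertV f hf) (fun hf => hshape hf) ?_
  intro K₀ _ _ _ _ ηq hηK hη1 κ γ hκ hγ hγK hγc N _ f hf ϖ hϖ Lη hL hne D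
  have h := pow_dvd_natCard_torsion_coinvariants_of_namedFacts_of_poitouTate_of_tamagawa h12 h13 h22
    h41 hPT hp5 hgood hap hsurj (fun f hf => hcertV f hf) hf ϖ hϖ Lη hL hne W C hCV T hpT hT hT1 K₀
    ηq hηK hη1 κ γ hκ hγ hγK hγc D 1 ha
  rwa [pow_one] at h

end Tamagawa

end Summit.BirchSwinnertonDyer.BirchSwinnertonDyer.Theorems

end
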